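import Literature.Barriers.RiemannHypothesis.TuranPartialSumsBohr
import Literature.Analysis.Complex.SumOfCircles
import Literature.Barriers.RiemannHypothesis.DavenportHeilbronnSeries
import Mathlib.Data.Nat.Factorization.Basic
import HarnessLib

/-!
# Sections of `ζ` beyond `σ = 1`: a finite criterion at `σ = 1` (free large primes + continuity)

Barrier catalogue `Literature/Barriers/RiemannHypothesis/`, companion of `TuranPartialSums.lean`
(the reduction step of the plan to prove `TuranPartialSums`). Everything here is PROVED.

To show that `ζ_N` has a zero in `σ > 1` it suffices (Bohr's equivalence theorem, in the tree as
`exists_zetaPartialSum_zero_of_twist_zero`, `TuranPartialSumsBohr.lean`) to find a completely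
multiplicative twist `a`, unimodular at the primes, and a real `σ₀ > 1` with
`∑_{n ≤ N} a(n) n^{-σ₀} = 0` (a real zero of `twistedPartialSum a N`). Following
Platt–Trudgian 2016, §2.2 ("`θ_{17}, θ_{19}, θ_{23}` only appear once in the sum"), fix unimodular
phases `ω(p)` only at a set `S` of primes containing every `p ≤ √N`, and leave the phases of the
remaining primes `T = {p ≤ N prime} ∖ S` (all `> √N`) free. Every `n ≤ N` is then either
`S`-smooth or `n = m·p` with exactly one `p ∈ T` (to the first power) and `m ≤ N/p < √N`
`S`-smooth, so for any choice `u` of the free phases (`twistedPartialSum_decomposition`)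

  `∑_{n ≤ N} a(n) n^{-σ} = B(σ) + ∑_{p ∈ T} u_p c_p(σ)`,
  `B(σ) = ∑_{n ≤ N, S-smooth} a_ω(n) n^{-σ}`, `c_p(σ) = ∑_{m ≤ N/p} a_ω(m) (mp)^{-σ}`

(`smoothSum`, `bigCoeff`; `a_φ = complMul φ`, the completely multiplicative extension of the prime
phases `φ`, `DavenportHeilbronnSeries.lean`). As `u` ranges over the torus, `∑ u_p c_p(σ)` covers
the closed disc of radius `∑ |c_p(σ)|` provided no `|c_p|` exceeds the sum of the others
(`SumOfCircles`). Hence the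

**Criterion** (`exists_zero_of_criterion`). If `|B(1)| < ∑_{p ∈ T} |c_p(1)|` and
`2|c_p(1)| < ∑_{q ∈ T} |c_q(1)|` for every `p ∈ T`, then `ζ_N(s) = 0` for some `Re s > 1`.

Indeed both strict inequalities persist for `σ₀ > 1` close to `1` (continuity), giving free phases
with `B(σ₀) + ∑ u_p c_p(σ₀) = 0`, i.e. a real zero `σ₀ > 1` of a twisted section. At `σ = 1` all
quantities are finite sums of `a_ω(n)/n`; with phases `ω(p) ∈ ℚ(i)` they are Gaussian rationals and
the criterion is decidable by exact arithmetic (`TuranPartialSumsCheck*.lean`).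

## References

* [PlattTrudgian2016] D. J. Platt, T. S. Trudgian, LMS J. Comput. Math. 19 (2016), 37–41, §2.2.
* [Montgomery1983] H. L. Montgomery, *Zeros of approximations to the zeta function* (1983), §2.
* [Titchmarsh1986] E. C. Titchmarsh, *The Theory of the Riemann Zeta-Function*, §11.5 (Bohr).
-/

noncomputable section

open Complex Filter Topology Finset

namespace Literature.Barriers.RiemannHypothesis

/-! ## Completely multiplicative extension of prime phases: two more lemmas on `complMul` -/

/-- `complMul φ n` depends only on the values of `φ` at the prime factors of `n` (`complMul`,
`DavenportHeilbronnSeries.lean`, is the completely multiplicative function with prescribed prime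
values; Apostol's `f` of Thm. 8.12). [folklore] -/
theorem complMul_congr {φ ψ : ℕ → ℂ} {n : ℕ} (h : ∀ p ∈ n.primeFactors, φ p = ψ p) :
    complMul φ n = complMul ψ n := by
  simp only [complMul, MonoidWithZeroHom.coe_mk, ZeroHom.coe_mk]
  rcases eq_or_ne n 0 with rfl | hn
  · simp
  rw [if_neg hn, if_neg hn, Finsupp.prod, Finsupp.prod]
  refine Finset.prod_congr rfl fun p hp ↦ ?_
  rw [Nat.support_factorization] at hp
  rw [h p hp]

/-- If `φ` is unimodular at every prime then so is `complMul φ`. [folklore] -/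
theorem norm_complMul_prime {φ : ℕ → ℂ} (h : ∀ p : ℕ, p.Prime → ‖φ p‖ = 1) {p : ℕ}
    (hp : p.Prime) : ‖complMul φ p‖ = 1 := by
  rw [complMul_prime φ hp]; exact h p hp

/-! ## The data of the criterion -/

/-- The **free primes**: the primes `p ≤ N` outside `S`. [cite: PlattTrudgian2016, §2.2] -/
def freePrimes (N : ℕ) (S : Finset ℕ) : Finset ℕ :=
  ((Finset.Icc 1 N).filter Nat.Prime) \ S

/-- `B(σ) = ∑_{n ≤ N, S-smooth} a_ω(n) n^{-σ}`: the part of the twisted section supported on the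
`S`-smooth integers (those all of whose prime factors lie in `S`).
[cite: PlattTrudgian2016, §2.2] -/
def smoothSum (N : ℕ) (S : Finset ℕ) (ω : ℕ → ℂ) (σ : ℝ) : ℂ :=
  ∑ n ∈ (Finset.Icc 1 N).filter (fun n ↦ n.primeFactors ⊆ S), complMul ω n * (n : ℂ) ^ (-(σ : ℂ))

/-- `c_p(σ) = ∑_{m ≤ N/p} a_ω(m) (mp)^{-σ}`: the coefficient of the free phase `u_p` in the twisted
section. [cite: PlattTrudgian2016, §2.2] -/
def bigCoeff (N : ℕ) (ω : ℕ → ℂ) (p : ℕ) (σ : ℝ) : ℂ :=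
  ∑ m ∈ Finset.Icc 1 (N / p), complMul ω m * ((m * p : ℕ) : ℂ) ^ (-(σ : ℂ))

/-- Membership in `freePrimes`. [folklore] -/
theorem mem_freePrimes {N : ℕ} {S : Finset ℕ} {p : ℕ} :
    p ∈ freePrimes N S ↔ (1 ≤ p ∧ p ≤ N) ∧ p.Prime ∧ p ∉ S := by
  simp [freePrimes, and_assoc]

/-! ## The decomposition of a twisted section along the free primes -/

section Decomposition

variable {N : ℕ} {S : Finset ℕ} (hSall : ∀ p : ℕ, p.Prime → p * p ≤ N → p ∈ S)
include hSall

/-- A free prime exceeds `√N`. [folklore] -/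
theorem lt_mul_self_of_mem_freePrimes {p : ℕ} (hp : p ∈ freePrimes N S) : N < p * p := by
  rw [mem_freePrimes] at hp
  by_contra h
  exact hp.2.2 (hSall p hp.2.1 (not_lt.1 h))

/-- If `n ≤ N` is not `S`-smooth then `n = m r` with `r` a free prime, `m ≤ N / r` `S`-smooth,
and no other free prime divides `n`. [folklore] -/
theorem exists_freePrime_of_not_smooth {n : ℕ} (hn1 : 1 ≤ n) (hnN : n ≤ N)
    (hns : ¬ n.primeFactors ⊆ S) :
    ∃ r ∈ freePrimes N S, r ∣ n ∧ (n / r).primeFactors ⊆ S ∧ 1 ≤ n / r ∧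
      ∀ r' ∈ freePrimes N S, r' ∣ n → r' = r := by
  obtain ⟨r, hr, hrS⟩ := Finset.not_subset.1 hns
  have hrp : r.Prime := Nat.prime_of_mem_primeFactors hr
  have hrn : r ∣ n := Nat.dvd_of_mem_primeFactors hr
  have hn0 : n ≠ 0 := by omega
  have hrle : r ≤ n := Nat.le_of_dvd (by omega) hrn
  have hrT : r ∈ freePrimes N S := mem_freePrimes.2 ⟨⟨hrp.one_lt.le, hrle.trans hnN⟩, hrp, hrS⟩
  have hrr : N < r * r := lt_mul_self_of_mem_freePrimes hSall hrT
  obtain ⟨m, rfl⟩ := hrn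
  have hm0 : m ≠ 0 := by rintro rfl; simp at hn0
  have hmr : r * m / r = m := Nat.mul_div_cancel_left m hrp.pos
  -- `m < r`, so every prime factor `q` of `m` has `q * q ≤ N`
  have hmlt : m < r := by
    by_contra h
    push Not at h
    have : r * r ≤ r * m := Nat.mul_le_mul_left r h
    omega
  refine ⟨r, hrT, dvd_mul_right r m, ?_, ?_, ?_⟩
  · rw [hmr]
    intro q hq
    have hqp : q.Prime := Nat.prime_of_mem_primeFactors hq
    have hqm : q ≤ m := Nat.le_of_dvd (Nat.pos_of_ne_zero hm0) (Nat.dvd_of_mem_primeFactors hq)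
    refine hSall q hqp ?_
    calc q * q ≤ m * m := Nat.mul_le_mul hqm hqm
      _ ≤ r * m := Nat.mul_le_mul_right m hmlt.le
      _ ≤ N := hnN
  · rw [hmr]; exact Nat.one_le_iff_ne_zero.2 hm0
  · intro r' hr' hr'n
    by_contra hne
    have hr'p : r'.Prime := (mem_freePrimes.1 hr').2.1
    have hr'r : N < r' * r' := lt_mul_self_of_mem_freePrimes hSall hr'
    -- `r' ∣ m`, so `m ≥ r'` and `n ≥ r r' > N`
    have hcop : Nat.Coprime r' r := (Nat.coprime_primes hr'p hrp).2 hne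
    have hr'm : r' ∣ m := hcop.dvd_of_dvd_mul_left hr'n
    have hr'le : r' ≤ m := Nat.le_of_dvd (Nat.pos_of_ne_zero hm0) hr'm
    have h1 : r' * r' ≤ r * m := by
      calc r' * r' ≤ m * m := Nat.mul_le_mul hr'le hr'le
        _ ≤ r * m := Nat.mul_le_mul_right m hmlt.le
    omega

/-- The value of a twisted-section term at `k = m r`, `r` a free prime, `m` `S`-smooth.
[folklore] -/
theorem complMul_term_eq {ω φ : ℕ → ℂ} (hφ : ∀ p ∈ S, φ p = ω p) (s : ℂ) {k m r : ℕ}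
    (hk : k = m * r) (hr : r.Prime) (hmS : m.primeFactors ⊆ S) :
    complMul φ k * (k : ℂ) ^ (-s) = φ r * (complMul ω m * ((m * r : ℕ) : ℂ) ^ (-s)) := by
  have _ := hSall
  rw [hk, map_mul, complMul_prime φ hr, complMul_congr (fun p hp ↦ hφ p (hmS hp))]
  ring

/-- **Decomposition along the free primes.** Let `S ⊇ {p prime : p² ≤ N}` carry the phases `ω`, let
`φ` agree with `ω` on `S`, and let `n ≤ N`. Then
`∑_{k ≤ n} a_φ(k) k^{-s} = ∑_{k ≤ n, S-smooth} a_ω(k) k^{-s} + ∑_{r free} φ(r) c_r(n)` with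
`c_r(n) = ∑_{m ≤ n/r} a_ω(m)(mr)^{-s}` (sums over `1 ≤ k`, `1 ≤ m`).
[cite: PlattTrudgian2016, §2.2] -/
theorem twistedPartialSum_decomposition {ω φ : ℕ → ℂ} (hφ : ∀ p ∈ S, φ p = ω p) (s : ℂ) :
    ∀ n : ℕ, n ≤ N →
      ∑ k ∈ Finset.Icc 1 n, complMul φ k * (k : ℂ) ^ (-s) =
        (∑ k ∈ (Finset.Icc 1 n).filter (fun k ↦ k.primeFactors ⊆ S),
            complMul ω k * (k : ℂ) ^ (-s)) +
          ∑ r ∈ freePrimes N S, φ r *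
            ∑ m ∈ Finset.Icc 1 (n / r), complMul ω m * ((m * r : ℕ) : ℂ) ^ (-s) := by
  -- notation: `f` the smooth terms, `C n r` the inner sums
  set f : ℕ → ℂ := fun k ↦ complMul ω k * (k : ℂ) ^ (-s) with hf
  set C : ℕ → ℕ → ℂ := fun n r ↦
    ∑ m ∈ Finset.Icc 1 (n / r), complMul ω m * ((m * r : ℕ) : ℂ) ^ (-s) with hC
  intro n
  induction n with
  | zero => intro _; simp
  | succ n ih =>
    intro hn
    have ih' := ih (by omega)
    rw [Finset.sum_Icc_succ_top (by omega), ih']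
    change _ = ∑ k ∈ (Finset.Icc 1 (n + 1)).filter (fun k ↦ k.primeFactors ⊆ S), f k +
      ∑ r ∈ freePrimes N S, φ r * C (n + 1) r
    change (∑ k ∈ (Finset.Icc 1 n).filter (fun k ↦ k.primeFactors ⊆ S), f k +
      ∑ r ∈ freePrimes N S, φ r * C n r) + _ = _
    by_cases hsm : (n + 1).primeFactors ⊆ S
    · -- smooth: the new term joins `B`; no free prime divides `n + 1`
      have hB : ∑ k ∈ (Finset.Icc 1 (n + 1)).filter (fun k ↦ k.primeFactors ⊆ S), f k =
          ∑ k ∈ (Finset.Icc 1 n).filter (fun k ↦ k.primeFactors ⊆ S), f k + f (n + 1) := by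
        rw [← Finset.insert_Icc_right_eq_Icc_add_one (by omega : 1 ≤ n + 1), Finset.filter_insert,
          if_pos hsm, Finset.sum_insert (by simp), add_comm]
      have hCC : ∑ r ∈ freePrimes N S, φ r * C (n + 1) r = ∑ r ∈ freePrimes N S, φ r * C n r := by
        refine Finset.sum_congr rfl fun r hr ↦ ?_
        have hrp : r.Prime := (mem_freePrimes.1 hr).2.1
        have hdiv : (n + 1) / r = n / r := by
          rw [Nat.succ_div_of_not_dvd]
          intro hrn
          have : r ∈ (n + 1).primeFactors := Nat.mem_primeFactors.2 ⟨hrp, hrn, by omega⟩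
          exact (mem_freePrimes.1 hr).2.2 (hsm this)
        simp only [hC, hdiv]
      have hφω : complMul φ (n + 1) * ((n + 1 : ℕ) : ℂ) ^ (-s) = f (n + 1) := by
        simp only [hf, complMul_congr fun p hp ↦ hφ p (hsm hp)]
      rw [hB, hCC, hφω]
      ring
    · -- not smooth: `n + 1 = m r` joins the coefficient of the free prime `r`
      obtain ⟨r, hrT, hrn, hmS, hm1, huniq⟩ :=
        exists_freePrime_of_not_smooth hSall (n := n + 1) (by omega) hn hsm
      have hrp : r.Prime := (mem_freePrimes.1 hrT).2.1
      have hB : ∑ k ∈ (Finset.Icc 1 (n + 1)).filter (fun k ↦ k.primeFactors ⊆ S), f k =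
          ∑ k ∈ (Finset.Icc 1 n).filter (fun k ↦ k.primeFactors ⊆ S), f k := by
        rw [← Finset.insert_Icc_right_eq_Icc_add_one (by omega : 1 ≤ n + 1), Finset.filter_insert,
          if_neg hsm]
      have hnm : n + 1 = (n + 1) / r * r := (Nat.div_mul_cancel hrn).symm
      have hval := complMul_term_eq hSall hφ s hnm hrp hmS
      -- the inner sum of `r` gains the term `m = (n+1)/r = n/r + 1`; the others are unchanged
      have hdivr : (n + 1) / r = n / r + 1 := Nat.succ_div_of_dvd hrn
      have hCr : C (n + 1) r =
          C n r + complMul ω ((n + 1) / r) * (((n + 1) / r * r : ℕ) : ℂ) ^ (-s) := by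
        simp only [hC]
        rw [hdivr, Finset.sum_Icc_succ_top (by omega)]
      have hCo : ∀ r' ∈ (freePrimes N S).erase r, φ r' * C (n + 1) r' = φ r' * C n r' := by
        intro r' hr'
        have hne : r' ≠ r := Finset.ne_of_mem_erase hr'
        have hr'T : r' ∈ freePrimes N S := Finset.mem_of_mem_erase hr'
        have hdiv : (n + 1) / r' = n / r' := by
          rw [Nat.succ_div_of_not_dvd]
          exact fun h ↦ hne (huniq r' hr'T h)
        simp only [hC, hdiv]
      have hCC : ∑ r' ∈ freePrimes N S, φ r' * C (n + 1) r' =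
          ∑ r' ∈ freePrimes N S, φ r' * C n r' + φ r * (complMul ω ((n + 1) / r) *
            (((n + 1) / r * r : ℕ) : ℂ) ^ (-s)) := by
        rw [← Finset.add_sum_erase _ _ hrT, ← Finset.add_sum_erase _ (fun r' ↦ φ r' * C n r') hrT,
          Finset.sum_congr rfl hCo, hCr]
        ring
      rw [hB, hCC, hval]
      ring

end Decomposition

/-! ## Continuity in `σ` -/

/-- `σ ↦ n^{-σ}` is continuous for `n ≠ 0`. [folklore] -/
theorem continuous_natCast_cpow_neg {n : ℕ} (hn : n ≠ 0) :
    Continuous fun σ : ℝ ↦ (n : ℂ) ^ (-(σ : ℂ)) :=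
  (Complex.continuous_ofReal.neg).const_cpow (Or.inl (Nat.cast_ne_zero.2 hn))

/-- `B` is continuous in `σ`. [folklore] -/
theorem continuous_smoothSum (N : ℕ) (S : Finset ℕ) (ω : ℕ → ℂ) :
    Continuous (smoothSum N S ω) := by
  unfold smoothSum
  refine continuous_finsetSum _ fun n hn ↦ ?_
  have hn1 : 1 ≤ n := (Finset.mem_Icc.1 (Finset.mem_filter.1 hn).1).1
  exact continuous_const.mul (continuous_natCast_cpow_neg (by omega))

/-- Each `c_p` (`p ≠ 0`) is continuous in `σ`. [folklore] -/
theorem continuous_bigCoeff (N : ℕ) (ω : ℕ → ℂ) {p : ℕ} (hp : p ≠ 0) :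
    Continuous (bigCoeff N ω p) := by
  unfold bigCoeff
  refine continuous_finsetSum _ fun m hm ↦ ?_
  have hm1 : 1 ≤ m := (Finset.mem_Icc.1 hm).1
  exact continuous_const.mul (continuous_natCast_cpow_neg (Nat.mul_ne_zero (by omega) hp))

/-! ## The criterion -/

/-- **The `σ = 1` criterion for a zero of `ζ_N` beyond `σ = 1`.** Let `S` be a set of primes
containing every prime `p` with `p² ≤ N`, with phases `ω(p)` unimodular at the primes `p ∈ S`, and
let
`T = freePrimes N S`. If `|B(1)| < ∑_{p ∈ T} |c_p(1)|` and `2|c_p(1)| < ∑_{q ∈ T} |c_q(1)|` for all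
`p ∈ T` (notation of this file), then `ζ_N(s) = 0` for some `s` with `Re s > 1`. (Continuity moves
both inequalities to some `σ₀ > 1`; the free phases then realise `−B(σ₀)` as `∑ u_p c_p(σ₀)`
(`SumOfCircles`), giving a real zero `σ₀` of the twisted section for the phases so defined, and the
tree's Bohr transfer `exists_zetaPartialSum_zero_of_twist_zero` applies.)
[cite: PlattTrudgian2016, §2.2] [cite: Montgomery1983, §2] -/
theorem exists_zero_of_criterion {N : ℕ} {S : Finset ℕ}
    (hSall : ∀ p : ℕ, p.Prime → p * p ≤ N → p ∈ S) {ω : ℕ → ℂ}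
    (hω : ∀ p ∈ S, p.Prime → ‖ω p‖ = 1)
    (h1 : ‖smoothSum N S ω 1‖ < ∑ p ∈ freePrimes N S, ‖bigCoeff N ω p 1‖)
    (h2 : ∀ p ∈ freePrimes N S,
      2 * ‖bigCoeff N ω p 1‖ < ∑ q ∈ freePrimes N S, ‖bigCoeff N ω q 1‖) :
    ∃ s : ℂ, 1 < s.re ∧ zetaPartialSum N s = 0 := by
  set T := freePrimes N S with hT
  have hTp : ∀ p ∈ T, p.Prime := fun p hp ↦ (mem_freePrimes.1 hp).2.1
  have hT0 : ∀ p ∈ T, p ≠ 0 := fun p hp ↦ (hTp p hp).ne_zero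
  -- Step 1: both strict inequalities hold at some `σ₀ > 1`
  set R : ℝ → ℝ := fun σ ↦ ∑ p ∈ T, ‖bigCoeff N ω p σ‖ with hR
  have hRc : Continuous R :=
    continuous_finsetSum _ fun p hp ↦ (continuous_bigCoeff N ω (hT0 p hp)).norm
  have hBc : Continuous fun σ ↦ ‖smoothSum N S ω σ‖ := (continuous_smoothSum N S ω).norm
  have hev1 : ∀ᶠ σ in 𝓝 (1 : ℝ), ‖smoothSum N S ω σ‖ < R σ :=
    (hBc.continuousAt).eventually_lt hRc.continuousAt h1
  have hev2 : ∀ᶠ σ in 𝓝 (1 : ℝ), ∀ p ∈ T, 2 * ‖bigCoeff N ω p σ‖ < R σ := by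
    rw [Filter.eventually_all_finset]
    intro p hp
    exact ((continuous_const.mul (continuous_bigCoeff N ω (hT0 p hp)).norm).continuousAt
      ).eventually_lt hRc.continuousAt (h2 p hp)
  have hev : ∀ᶠ σ in 𝓝[>] (1 : ℝ),
      (‖smoothSum N S ω σ‖ < R σ ∧ ∀ p ∈ T, 2 * ‖bigCoeff N ω p σ‖ < R σ) ∧ 1 < σ :=
    ((hev1.and hev2).filter_mono nhdsWithin_le_nhds).and self_mem_nhdsWithin
  obtain ⟨σ₀, ⟨hB₀, hdisc₀⟩, hσ₀⟩ := hev.exists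
  -- Step 2: free phases `u` with `∑ ‖c_p(σ₀)‖ u_p = −B(σ₀)`, then `v_p` with
  -- `∑ c_p(σ₀) v_p = −B(σ₀)`
  obtain ⟨u, hun, hus⟩ := Literature.Analysis.Complex.exists_unimodular_sum_eq_of_two_mul_le T
    (fun p ↦ ‖bigCoeff N ω p σ₀‖) (fun p _ ↦ norm_nonneg _) (fun p hp ↦ (hdisc₀ p hp).le)
    (-smoothSum N S ω σ₀) (by rw [norm_neg]; exact hB₀.le)
  set v : ℕ → ℂ := fun p ↦
    if bigCoeff N ω p σ₀ = 0 then 1 else u p * ‖bigCoeff N ω p σ₀‖ / bigCoeff N ω p σ₀ with hv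
  have hvn : ∀ p ∈ T, ‖v p‖ = 1 := by
    intro p hp
    by_cases hc : bigCoeff N ω p σ₀ = 0
    · simp [hv, hc]
    · rw [hv]; simp only [hc, if_false]
      rw [norm_div, norm_mul, hun p hp, one_mul, Complex.norm_real, Real.norm_eq_abs,
        abs_of_nonneg (norm_nonneg _), div_self (norm_ne_zero_iff.2 hc)]
  have hvc : ∀ p ∈ T, v p * bigCoeff N ω p σ₀ = (‖bigCoeff N ω p σ₀‖ : ℂ) * u p := by
    intro p hp
    by_cases hc : bigCoeff N ω p σ₀ = 0
    · simp [hv, hc]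
    · rw [hv]; simp only [hc, if_false]
      field_simp
  have hsum0 : smoothSum N S ω σ₀ + ∑ p ∈ T, v p * bigCoeff N ω p σ₀ = 0 := by
    rw [Finset.sum_congr rfl hvc, hus]; ring
  -- Step 3: the torus point
  classical
  set φ : ℕ → ℂ := fun p ↦ if p ∈ S then ω p else if p ∈ T then v p else 1 with hφ
  have hφS : ∀ p ∈ S, φ p = ω p := fun p hp ↦ by simp [hφ, hp]
  have hφT : ∀ p ∈ T, φ p = v p := by
    intro p hp
    have hpS : p ∉ S := (mem_freePrimes.1 hp).2.2
    simp [hφ, hpS, hp]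
  have hφu : ∀ p : ℕ, p.Prime → ‖φ p‖ = 1 := by
    intro p hp
    by_cases hpS : p ∈ S
    · rw [hφS p hpS]; exact hω p hpS hp
    · by_cases hpT : p ∈ T
      · rw [hφT p hpT]; exact hvn p hpT
      · simp [hφ, hpS, hpT]
  -- `N ≥ 1` (for `N = 0` there are no free primes and `h1` is absurd)
  have hN : 1 ≤ N := by
    by_contra hN0
    have hT0 : T = ∅ := by
      rw [hT, freePrimes, show N = 0 by omega]
      simp
    rw [hT0, Finset.sum_empty] at h1
    linarith [norm_nonneg (smoothSum N S ω 1)]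
  -- Step 4: the twisted section of `a_φ` vanishes at `σ₀`; Bohr's transfer finishes
  have hzero : twistedPartialSum (complMul φ) N (σ₀ : ℂ) = 0 := by
    rw [twistedPartialSum, twistedPartialSum_decomposition hSall hφS (σ₀ : ℂ) N le_rfl]
    have : ∑ r ∈ T, φ r * ∑ m ∈ Finset.Icc 1 (N / r), complMul ω m * ((m * r : ℕ) : ℂ) ^ (-(σ₀ : ℂ))
        = ∑ p ∈ T, v p * bigCoeff N ω p σ₀ :=
      Finset.sum_congr rfl fun r hr ↦ by rw [hφT r hr]; rfl
    rw [hT] at this hsum0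
    rw [this]
    exact hsum0
  obtain ⟨s, hs0, hsre, -⟩ := exists_zetaPartialSum_zero_of_twist_zero
    (fun m n _ _ ↦ map_mul (complMul φ) m n) (fun p hp ↦ norm_complMul_prime hφu hp) hN hzero
    (c := 1) (by simpa using hσ₀) 0
  exact ⟨s, hsre, hs0⟩

end Literature.Barriers.RiemannHypothesis
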